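import Mathlib
import Literature.NumberTheory.DiophantineApproximation.DilogHermitePade
import HarnessLib

/-!
# Fischler–Rivoal 2003: Padé approximants and balanced hypergeometric series

Topic `Literature/NumberTheory/Irrationality/FischlerRivoal2003`. Source (read on the page this session):
S. Fischler, T. Rivoal, *Approximants de Padé et séries hypergéométriques équilibrées*, J. Math. Pures Appl. **82**
(2003) 1369–1394 [FischlerRivoal2003]. Page numbers below are those of the journal.

The paper answers the question (Rivoal's thesis, p. 53) of exhibiting EXPLICIT Padé approximation problems whose
unique solutions are the nearly-poised, well-poised and very-well-poised hypergeometric series used in the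
irrationality / linear independence results for `ζ(2n+1)` (Ball–Rivoal) and for polylogarithms (Nikishin, Rivoal):
a Padé problem at the three points `z = ∞, 0, 1` for `1, Li₁, …, Li_a` (problem (8)), its very-well-poised variant
(problem (19)), and the reciprocity `z ↦ 1/z` of the solutions which makes half of the zeta values disappear.

HONEST FRAMING (cells pub-zeta5 / zeta5-irr): this file is VOCABULARY and four NAMED FACTS (statements as printed,
no proof claimed here except the elementary `thm4Pa_eval_neg_one_pow`); nothing in it is a claim about `ζ(5)`.

## The Padé problem (8) (p. 1372–1373) and how it is typed

"Considérons des entiers `n ≥ 0`, `a ≥ 1` et `ρ, σ ≥ 0` vérifiant `ρ + σ ≤ a(n+1) − 1` … Nous voulons déterminer des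
polynômes `P₀`, `P̄₀` et `P_j` (pour `1 ≤ j ≤ a`) de degré au plus `n` et des fonctions `S`, `S̄`, `R` tels que

  `S(z) = P₀(z) + Σ_{j=1}^{a} P_j(z) Li_j(1/z) = O(z^{−ρ−1})`   (at `z = ∞`),
  `S̄(z) = P̄₀(z) + Σ_{j=1}^{a} (−1)^j P_j(z) Li_j(z) = O(z^{n+σ+1})`   (at `z = 0`),
  `R(z) = Σ_{j=1}^{a} (−1)^{j−1} P_j(z) log^{j−1}(z)/(j−1)! = O((1−z)^{a(n+1)−ρ−σ−1})`   (at `z = 1`)."   (8)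

"uniqueness" means (Remarque, p. 1373): the solution is unique up to a multiplicative constant.

All three conditions are identities of FORMAL power series, and they are typed as such over `ℂ`:
* at `∞`, in the variable `w = 1/z` after multiplication by `wⁿ`:
  `wⁿ S(1/w) = reflect n P₀ + Σ_j (reflect n P_j)·L_j(w)` with `L_j(w) = Σ_{k≥1} w^k/k^j` (`polylogFPS j`), and
  `S = O(z^{−ρ−1})` iff the coefficients of `w^0, …, w^{n+ρ}` vanish (`expansionAtInfinity`);
* at `0`, in `z`: `P̄₀ + Σ_j (−1)^j P_j · L_j(z)`, coefficients of `z^0, …, z^{n+σ}` vanish (`expansionAtZero`);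
* at `1`, in `u = 1 − z` (principal branch, `log z = log(1−u) = −Σ_{k≥1} u^k/k`, `logFPS`):
  `Σ_j (−1)^{j−1}/(j−1)! · P_j(1−u) · log(1−u)^{j−1}`, coefficients of `u^0, …, u^{N−1}` vanish (`expansionAtOne`),
  with `N = a(n+1) − ρ − σ − 1` for (8).
`IsPadeSolution n a ρ σ N P₀ P̄₀ P` bundles the degree bounds and the three vanishing conditions, with the order `N`
at `z = 1` as a parameter so that problem (19) (`σ = ρ`, `N = a(n+1) − 2ρ − 2`, plus `P_a((−1)^a) = 0`) reuses it.

## What is printed and what is typed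

* **Théorème 1** (p. 1373). "À constante multiplicative près, le problème de Padé (8) a une unique solution, et elle
  vérifie pour tout `z ∈ ℂ` tel que `|z| ≥ 1`,
  `S(z) = Σ_{k=1}^{∞} (k − ρ)_ρ (k + n + 1)_σ / (k)_{n+1}^a · z^{−k}`   (9)
  `P_a(z) = Σ_{k=0}^{n} (−1)^{ka} (−k − ρ)_ρ (n − k + 1)_σ / (k!^a (n − k)!^a) · z^k`   (10)
  et, si `z ∉ ]−∞, 0]`, `R(z) = (2iπ)^{−1} ∫_C (s − ρ)_ρ (s + n + 1)_σ/(s)_{n+1}^a z^{−s} ds`   (11)."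
  (`(x)_m` is the ascending Pochhammer symbol.) NAMED FACT `theoreme1`: existence of a solution with `P_a` = (10) and
  `wⁿS` = `wⁿ · (9)` as formal series, and every solution proportional to it. The integral (11) is not typed.
* **Proposition 1** (p. 1374), reciprocity between the problems `(ρ, σ)` and `(σ, ρ)` for the solutions normalised
  by (10): "`zⁿ P_{j,σ,ρ}(1/z) = (−1)^{a(n+1)+ρ+σ+j} P_{j,ρ,σ}(z)` pour `j ∈ {1, …, a}`" (the accompanying identities
  for `S̄`, `R` are not typed). NAMED FACT `proposition1`. Its Remarque — for `σ = ρ` and `a(n+1)+j` odd,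
  `P_{j,ρ,ρ}(1) = 0`, so `S_{ρ,ρ}(1)` is a rational form in `1` and the `ζ(j)` with `j ≢ a(n+1) (mod 2)` — is the
  phenomenon proved in the tree as `Literature.NumberTheory.Irrationality.CressonFischlerRivoal2008.theoreme1_holds`.
* **Théorème 2** (p. 1374). "Soient `λ, μ` deux réels et `α` un rationnel tels que `(λ, μ) ≠ (0, 0)` et `0 < α < 1`.
  L'ensemble `{λ Li_s(α) + μ log^s(α)/(s − 1)!, s ∈ ℕ*}` contient une infinité de nombres linéairement indépendants
  sur `ℚ`." NAMED FACT `theoreme2`, with `Li_s(α)` the tree's real series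
  `Literature.NumberTheory.DiophantineApproximation.DilogPade.polylogSeries s α = Σ_{k≥1} α^k/k^s`.
* **Théorème 3** (p. 1375). "Au moins l'un des trois nombres `Li₂(1/2) + log²(2)`, `Li₃(1/2) − ½ log³(2)`,
  `Li₄(1/2) + ⅙ log⁴(2)` est irrationnel." NAMED FACT `theoreme3`.
* **Problem (19) and Théorème 4** (§3, p. 1379–1380). "Considérons des entiers `n ≥ 0`, `a ≥ 1` et `ρ ≥ 0` vérifiant
  `2ρ ≤ a(n+1) − 2`"; (19) is (8) with `σ = ρ`, the order at `z = 1` lowered to `O((1−z)^{a(n+1)−2ρ−2})`, and the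
  extra condition `P_a((−1)^a) = 0`. "Théorème 4. À une constante multiplicative près, le problème de Padé (19) a une
  solution unique, et elle vérifie
  `S(z) = Σ_{k=1}^{∞} (k + n/2) (k − ρ)_ρ (k + n + 1)_ρ / (k)_{n+1}^a · z^{−k}`   (20)
  et `P_a(z) = Σ_{k=0}^{n} (−1)^{ka} (n/2 − k) (−k − ρ)_ρ (n − k + 1)_ρ / (k!^a (n − k)!^a) · z^k`   (21).
  De plus, pour tout `j = 1, …, a`, on a : `zⁿ P_j(1/z) = (−1)^{a(n+1)+j+1} P_j(z)`   (22)" (the companion identity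
  for `S̄` in (22) is not typed). NAMED FACT `theoreme4`. PROVED: `thm4Pa_eval_neg_one_pow`, the half of the proof
  on p. 1381 saying that (21) does satisfy `P_a((−1)^a) = 0` ("le changement de `k` en `n − k` change `P_a((−1)^a)`
  en son opposé").

Reading of the scan fixed by exact computation (this session, `scratch/fr2003_check.py`, rational arithmetic): with
`(k)_{n+1}^a` in the denominators of (9), (20) and the data (10), (21), the three order conditions of (8) resp. (19),
the formula for `P_a`, `P_a((−1)^a) = 0` and the reciprocity (22) were verified exactly for eleven parameter sets
`(n, a, ρ, σ)` with `n ≤ 4`, `a ≤ 4`.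

Théorèmes 5, 6 (§4, the generalisation with derived series) and §5 are not typed.
-/

open Finset Polynomial

noncomputable section

namespace Literature.NumberTheory.Irrationality.FischlerRivoal2003

/-! ## Formal series vocabulary -/

/-- The Taylor series of the polylogarithm `Li_j` at `0` as a formal power series:
`L_j(w) = Σ_{k ≥ 1} w^k / k^j` (so `L_1(w) = −log(1 − w)`). [cite: FischlerRivoal2003, §1 (8) p. 1373] -/
def polylogFPS (j : ℕ) : PowerSeries ℂ :=
  PowerSeries.mk fun k => if k = 0 then 0 else 1 / (k : ℂ) ^ j

/-- The series of `log z` at `z = 1` in the variable `u = 1 − z` (principal branch):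
`log(1 − u) = −Σ_{k ≥ 1} u^k / k`. [cite: FischlerRivoal2003, §1 (8) p. 1373] -/
def logFPS : PowerSeries ℂ :=
  PowerSeries.mk fun k => if k = 0 then 0 else -1 / (k : ℂ)

/-- Coefficients of `L_j`: `[w^k] L_j(w) = 1/k^j` for `k ≥ 1`, `0` for `k = 0`.
[cite: FischlerRivoal2003, §1 p. 1370] -/
@[simp] theorem coeff_polylogFPS (j k : ℕ) :
    PowerSeries.coeff k (polylogFPS j) = if k = 0 then 0 else 1 / (k : ℂ) ^ j := by
  simp [polylogFPS]

/-- Coefficients of `log(1 − u)`: `[u^k] = −1/k` for `k ≥ 1`, `0` for `k = 0`.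
[cite: FischlerRivoal2003, §1 (8) p. 1373] -/
@[simp] theorem coeff_logFPS (k : ℕ) :
    PowerSeries.coeff k logFPS = if k = 0 then 0 else -1 / (k : ℂ) := by
  simp [logFPS]

/-- `L_1(u) = −log(1 − u)` coefficientwise. [cite: FischlerRivoal2003, §1 p. 1370] -/
theorem polylogFPS_one : polylogFPS 1 = -logFPS := by
  ext k
  simp only [coeff_polylogFPS, pow_one, map_neg, coeff_logFPS]
  split_ifs <;> ring

/-- The expansion at `z = ∞` of problem (8), in the variable `w = 1/z` and multiplied by `wⁿ`:
`wⁿ S(1/w) = wⁿP₀(1/w) + Σ_{j=1}^{a} wⁿP_j(1/w) · L_j(w)` (for polynomials of degree `≤ n`, `wⁿP(1/w)` is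
`Polynomial.reflect n P`). [cite: FischlerRivoal2003, §1 (8) p. 1373] -/
def expansionAtInfinity (n a : ℕ) (P₀ : ℂ[X]) (P : ℕ → ℂ[X]) : PowerSeries ℂ :=
  ((reflect n P₀ : ℂ[X]) : PowerSeries ℂ) +
    ∑ j ∈ Icc 1 a, ((reflect n (P j) : ℂ[X]) : PowerSeries ℂ) * polylogFPS j

/-- The expansion at `z = 0` of problem (8): `S̄(z) = P̄₀(z) + Σ_{j=1}^{a} (−1)^j P_j(z) L_j(z)`.
[cite: FischlerRivoal2003, §1 (8) p. 1373] -/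
def expansionAtZero (a : ℕ) (Pbar₀ : ℂ[X]) (P : ℕ → ℂ[X]) : PowerSeries ℂ :=
  (Pbar₀ : PowerSeries ℂ) + ∑ j ∈ Icc 1 a, ((-1 : ℂ) ^ j) • (((P j : ℂ[X]) : PowerSeries ℂ) * polylogFPS j)

/-- The expansion at `z = 1` of problem (8), in the variable `u = 1 − z`:
`R(1 − u) = Σ_{j=1}^{a} (−1)^{j−1}/(j−1)! · P_j(1 − u) · log(1 − u)^{j−1}`.
[cite: FischlerRivoal2003, §1 (8) p. 1373] -/
def expansionAtOne (a : ℕ) (P : ℕ → ℂ[X]) : PowerSeries ℂ :=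
  ∑ j ∈ Icc 1 a, ((-1 : ℂ) ^ (j - 1) / ((j - 1).factorial : ℂ)) •
    ((((P j).comp (1 - X) : ℂ[X]) : PowerSeries ℂ) * logFPS ^ (j - 1))

/-- A solution of the three-point Padé problem of [FR2003] with parameters `(n, a, ρ, σ)` and order `N` at `z = 1`:
polynomials `P₀, P̄₀, P_1, …, P_a` (the values `P j` for `j ∉ [1, a]` are ignored) of degree `≤ n` with
`S(z) = O(z^{−ρ−1})` at `∞`, `S̄(z) = O(z^{n+σ+1})` at `0` and `R(z) = O((1−z)^N)` at `1`. Problem (8) is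
`N = a(n+1) − ρ − σ − 1`; problem (19) is `σ = ρ`, `N = a(n+1) − 2ρ − 2` together with `P_a((−1)^a) = 0`.
[cite: FischlerRivoal2003, §1 (8) p. 1373 and §3 (19) p. 1379] -/
structure IsPadeSolution (n a ρ σ N : ℕ) (P₀ Pbar₀ : ℂ[X]) (P : ℕ → ℂ[X]) : Prop where
  natDegree_P₀ : P₀.natDegree ≤ n
  natDegree_Pbar₀ : Pbar₀.natDegree ≤ n
  natDegree_P : ∀ j ∈ Icc 1 a, (P j).natDegree ≤ n
  atInfinity : ∀ k < n + ρ + 1, PowerSeries.coeff k (expansionAtInfinity n a P₀ P) = 0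
  atZero : ∀ k < n + σ + 1, PowerSeries.coeff k (expansionAtZero a Pbar₀ P) = 0
  atOne : ∀ k < N, PowerSeries.coeff k (expansionAtOne a P) = 0

/-! ## Théorème 1: nearly-poised series (p. 1373) -/

/-- The series (9) in the variable `w = 1/z`: coefficient of `w^k`, `k ≥ 1`, is
`(k − ρ)_ρ (k + n + 1)_σ / (k)_{n+1}^a` (ascending Pochhammer symbols); so `wⁿ S(1/w) = wⁿ · thm1Series`.
[cite: FischlerRivoal2003, Théorème 1 (9) p. 1373] -/
def thm1Series (n a ρ σ : ℕ) : PowerSeries ℂ :=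
  PowerSeries.mk fun k => if k = 0 then 0 else
    (ascPochhammer ℂ ρ).eval ((k : ℂ) - ρ) * (ascPochhammer ℂ σ).eval ((k : ℂ) + n + 1) /
      ((ascPochhammer ℂ (n + 1)).eval (k : ℂ)) ^ a

/-- The normalisation (10): `P_a(z) = Σ_{k=0}^{n} (−1)^{ka} (−k − ρ)_ρ (n − k + 1)_σ / (k!^a (n−k)!^a) z^k`.
[cite: FischlerRivoal2003, Théorème 1 (10) p. 1373] -/
def thm1Pa (n a ρ σ : ℕ) : ℂ[X] :=
  ∑ k ∈ range (n + 1), C ((-1 : ℂ) ^ (k * a) *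
    ((ascPochhammer ℂ ρ).eval (-(k : ℂ) - ρ) * (ascPochhammer ℂ σ).eval ((n : ℂ) - k + 1)) /
      ((k.factorial : ℂ) ^ a * ((n - k).factorial : ℂ) ^ a)) * X ^ k

/-- **Théorème 1** (Fischler–Rivoal 2003). For integers `n ≥ 0`, `a ≥ 1`, `ρ, σ ≥ 0` with `ρ + σ ≤ a(n+1) − 1`, the
Padé problem (8) has, up to a multiplicative constant, a unique solution; normalised by (10) its function `S` is the
nearly-poised series (9), `S(z) = Σ_{k≥1} (k − ρ)_ρ (k + n + 1)_σ/(k)_{n+1}^a z^{−k}`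
(`= z^{−ρ−1} ρ!^{a+1}(ρ+σ+n+1)!/(ρ+n+1)!^{a+1} · _{a+2}F_{a+1}(ρ+σ+n+2, ρ+1, …, ρ+1; ρ+n+2, …, ρ+n+2; 1/z)`).
Typed: existence of a solution with `P_a` = (10) and `wⁿS(1/w) = wⁿ·(9)`, and proportionality of every solution to
it; the integral representation (11) of `R` is not typed. [cite: FischlerRivoal2003, Théorème 1 p. 1373] -/
def theoreme1 : Prop :=
  ∀ n a ρ σ : ℕ, 1 ≤ a → ρ + σ + 1 ≤ a * (n + 1) →
    ∃ (P₀ Pbar₀ : ℂ[X]) (P : ℕ → ℂ[X]),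
      IsPadeSolution n a ρ σ (a * (n + 1) - ρ - σ - 1) P₀ Pbar₀ P ∧
      P a = thm1Pa n a ρ σ ∧
      expansionAtInfinity n a P₀ P = PowerSeries.X ^ n * thm1Series n a ρ σ ∧
      ∀ (Q₀ Qbar₀ : ℂ[X]) (Q : ℕ → ℂ[X]), IsPadeSolution n a ρ σ (a * (n + 1) - ρ - σ - 1) Q₀ Qbar₀ Q →
        ∃ c : ℂ, Q₀ = c • P₀ ∧ Qbar₀ = c • Pbar₀ ∧ ∀ j ∈ Icc 1 a, Q j = c • P j

/-- **Proposition 1** (Fischler–Rivoal 2003), reciprocity. Writing `(P_{j,ρ,σ})_{1≤j≤a}` for the solution of (8)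
with parameters `(n, a, ρ, σ)` normalised by (10): `zⁿ P_{j,σ,ρ}(1/z) = (−1)^{a(n+1)+ρ+σ+j} P_{j,ρ,σ}(z)` for
`j ∈ {1, …, a}` (in particular for `σ = ρ`: `zⁿ P_{j,ρ,ρ}(1/z) = (−1)^{a(n+1)+j} P_{j,ρ,ρ}(z)`). Typed for any pair
of solutions normalised by (10) (unique by Théorème 1); the identities for `S̄` and `R` are not typed.
[cite: FischlerRivoal2003, Proposition 1 p. 1374] -/
def proposition1 : Prop :=
  ∀ n a ρ σ : ℕ, 1 ≤ a → ρ + σ + 1 ≤ a * (n + 1) →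
    ∀ (P₀ Pbar₀ : ℂ[X]) (P : ℕ → ℂ[X]) (Q₀ Qbar₀ : ℂ[X]) (Q : ℕ → ℂ[X]),
      IsPadeSolution n a ρ σ (a * (n + 1) - ρ - σ - 1) P₀ Pbar₀ P → P a = thm1Pa n a ρ σ →
      IsPadeSolution n a σ ρ (a * (n + 1) - ρ - σ - 1) Q₀ Qbar₀ Q → Q a = thm1Pa n a σ ρ →
        ∀ j ∈ Icc 1 a, reflect n (Q j) = ((-1 : ℂ) ^ (a * (n + 1) + ρ + σ + j)) • P j

/-! ## Théorèmes 2 and 3: polylogarithms and powers of the logarithm (p. 1374–1375) -/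

open Literature.NumberTheory.DiophantineApproximation in
/-- The numbers of Théorème 2: `λ Li_s(α) + μ log^s(α)/(s−1)!`, with `Li_s(α) = Σ_{k≥1} α^k/k^s` the tree's
`DilogPade.polylogSeries`. [cite: FischlerRivoal2003, Théorème 2 p. 1374] -/
def thm2Value (lam mu : ℝ) (α : ℚ) (s : ℕ) : ℝ :=
  lam * DilogPade.polylogSeries s (α : ℝ) + mu * Real.log (α : ℝ) ^ s / ((s - 1).factorial : ℝ)

/-- **Théorème 2** (Fischler–Rivoal 2003). Let `λ, μ` be real numbers and `α` a rational number with
`(λ, μ) ≠ (0, 0)` and `0 < α < 1`. Then the set `{λ Li_s(α) + μ log^s(α)/(s−1)! : s ≥ 1}` contains infinitely many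
numbers linearly independent over `ℚ` (typed: an infinite set of indices `s ≥ 1` on which the family is `ℚ`-linearly
independent). [cite: FischlerRivoal2003, Théorème 2 p. 1374] -/
def theoreme2 : Prop :=
  ∀ (lam mu : ℝ) (α : ℚ), (lam, mu) ≠ (0, 0) → 0 < α → α < 1 →
    ∃ T : Set ℕ, T.Infinite ∧ (∀ s ∈ T, 1 ≤ s) ∧
      LinearIndependent ℚ (fun s : T => thm2Value lam mu α (s : ℕ))

open Literature.NumberTheory.DiophantineApproximation in
/-- **Théorème 3** (Fischler–Rivoal 2003). At least one of the three numbers `Li₂(1/2) + log²2`,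
`Li₃(1/2) − ½ log³2`, `Li₄(1/2) + ⅙ log⁴2` is irrational. [cite: FischlerRivoal2003, Théorème 3 p. 1375] -/
def theoreme3 : Prop :=
  Irrational (DilogPade.polylogSeries 2 (1 / 2) + Real.log 2 ^ 2) ∨
    Irrational (DilogPade.polylogSeries 3 (1 / 2) - Real.log 2 ^ 3 / 2) ∨
    Irrational (DilogPade.polylogSeries 4 (1 / 2) + Real.log 2 ^ 4 / 6)

/-! ## Théorème 4: very-well-poised series (§3, p. 1379–1381) -/

/-- The series (20) in the variable `w = 1/z`: coefficient of `w^k`, `k ≥ 1`, is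
`(k + n/2) (k − ρ)_ρ (k + n + 1)_ρ / (k)_{n+1}^a`. [cite: FischlerRivoal2003, Théorème 4 (20) p. 1379] -/
def thm4Series (n a ρ : ℕ) : PowerSeries ℂ :=
  PowerSeries.mk fun k => if k = 0 then 0 else
    ((k : ℂ) + n / 2) * ((ascPochhammer ℂ ρ).eval ((k : ℂ) - ρ) * (ascPochhammer ℂ ρ).eval ((k : ℂ) + n + 1)) /
      ((ascPochhammer ℂ (n + 1)).eval (k : ℂ)) ^ a

/-- The normalisation (21): `P_a(z) = Σ_{k=0}^{n} (−1)^{ka} (n/2 − k) (−k − ρ)_ρ (n − k + 1)_ρ / (k!^a (n−k)!^a) z^k`.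
[cite: FischlerRivoal2003, Théorème 4 (21) p. 1380] -/
def thm4Pa (n a ρ : ℕ) : ℂ[X] :=
  ∑ k ∈ range (n + 1), C ((-1 : ℂ) ^ (k * a) * (((n : ℂ) / 2 - k) *
    ((ascPochhammer ℂ ρ).eval (-(k : ℂ) - ρ) * (ascPochhammer ℂ ρ).eval ((n : ℂ) - k + 1))) /
      ((k.factorial : ℂ) ^ a * ((n - k).factorial : ℂ) ^ a)) * X ^ k

/-- **Théorème 4** (Fischler–Rivoal 2003). For integers `n ≥ 0`, `a ≥ 1`, `ρ ≥ 0` with `2ρ ≤ a(n+1) − 2`, the Padé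
problem (19) — (8) with `σ = ρ`, order `O((1−z)^{a(n+1)−2ρ−2})` at `z = 1`, and `P_a((−1)^a) = 0` — has, up to a
multiplicative constant, a unique solution; it satisfies (20)
`S(z) = Σ_{k≥1} (k + n/2)(k − ρ)_ρ (k + n + 1)_ρ/(k)_{n+1}^a z^{−k}` (a very-well-poised `_{a+3}F_{a+2}(−1/z)`),
(21) for `P_a`, and the reciprocity (22) `zⁿ P_j(1/z) = (−1)^{a(n+1)+j+1} P_j(z)` for `j = 1, …, a`. Typed as for
`theoreme1`; the identity for `S̄` in (22) is not typed. [cite: FischlerRivoal2003, Théorème 4 p. 1379–1380] -/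
def theoreme4 : Prop :=
  ∀ n a ρ : ℕ, 1 ≤ a → 2 * ρ + 2 ≤ a * (n + 1) →
    ∃ (P₀ Pbar₀ : ℂ[X]) (P : ℕ → ℂ[X]),
      (IsPadeSolution n a ρ ρ (a * (n + 1) - 2 * ρ - 2) P₀ Pbar₀ P ∧ (P a).eval ((-1 : ℂ) ^ a) = 0) ∧
      P a = thm4Pa n a ρ ∧
      expansionAtInfinity n a P₀ P = PowerSeries.X ^ n * thm4Series n a ρ ∧
      (∀ j ∈ Icc 1 a, reflect n (P j) = ((-1 : ℂ) ^ (a * (n + 1) + j + 1)) • P j) ∧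
      ∀ (Q₀ Qbar₀ : ℂ[X]) (Q : ℕ → ℂ[X]),
        IsPadeSolution n a ρ ρ (a * (n + 1) - 2 * ρ - 2) Q₀ Qbar₀ Q → (Q a).eval ((-1 : ℂ) ^ a) = 0 →
        ∃ c : ℂ, Q₀ = c • P₀ ∧ Qbar₀ = c • Pbar₀ ∧ ∀ j ∈ Icc 1 a, Q j = c • P j

/-- `(−m − ρ)_ρ = (−1)^ρ (m + 1)_ρ` ("l'identité triviale `(α)_k = (−1)^k (−α − k + 1)_k`", p. 1374).
[cite: FischlerRivoal2003, p. 1374] -/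
theorem ascPochhammer_eval_neg_sub (ρ : ℕ) (m : ℂ) :
    (ascPochhammer ℂ ρ).eval (-m - ρ) = (-1) ^ ρ * (ascPochhammer ℂ ρ).eval (m + 1) := by
  rw [show -m - (ρ : ℂ) = -(m + ρ) by ring, ascPochhammer_eval_neg_eq_descPochhammer,
    descPochhammer_eval_eq_ascPochhammer]
  congr 2
  ring

/-- The polynomial (21) satisfies the extra condition of problem (19): `P_a((−1)^a) = 0` — the summands of
`P_a((−1)^a) = Σ_k (n/2 − k)(−k−ρ)_ρ(n−k+1)_ρ/(k!^a(n−k)!^a)` change sign under `k ↦ n − k` (p. 1381).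
[cite: FischlerRivoal2003, Théorème 4, proof p. 1380–1381] -/
theorem thm4Pa_eval_neg_one_pow (n a ρ : ℕ) : (thm4Pa n a ρ).eval ((-1 : ℂ) ^ a) = 0 := by
  -- the summand after evaluation, written with `(−k−ρ)_ρ = (−1)^ρ (k+1)_ρ`
  set e : ℕ → ℂ := fun k => ((n : ℂ) / 2 - k) *
    ((ascPochhammer ℂ ρ).eval ((k : ℂ) + 1) * (ascPochhammer ℂ ρ).eval ((n : ℂ) - k + 1)) /
      ((k.factorial : ℂ) ^ a * ((n - k).factorial : ℂ) ^ a) with he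
  have h1 : (thm4Pa n a ρ).eval ((-1 : ℂ) ^ a) = (-1) ^ ρ * ∑ k ∈ range (n + 1), e k := by
    simp only [thm4Pa, eval_finsetSum, eval_mul, eval_C, eval_pow, eval_X, mul_sum]
    refine sum_congr rfl fun k _ => ?_
    rw [ascPochhammer_eval_neg_sub, ← pow_mul, show a * k = k * a by ring, he]
    have h : ((-1 : ℂ) ^ (k * a)) ^ 2 = 1 := by
      rw [← pow_mul, show k * a * 2 = 2 * (k * a) by ring, pow_mul, neg_one_sq, one_pow]
    linear_combination ((n : ℂ) / 2 - k) * ((ascPochhammer ℂ ρ).eval ((k : ℂ) + 1) *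
      (ascPochhammer ℂ ρ).eval ((n : ℂ) - k + 1)) / ((k.factorial : ℂ) ^ a * ((n - k).factorial : ℂ) ^ a) *
        (-1) ^ ρ * h
  -- antisymmetry under `k ↦ n − k`
  have h2 : ∀ k ∈ range (n + 1), e (n - k) = -e k := by
    intro k hk
    have hk : k ≤ n := Nat.lt_succ_iff.mp (mem_range.mp hk)
    simp only [he, Nat.cast_sub hk, Nat.sub_sub_self hk]
    ring
  have h3 : ∑ k ∈ range (n + 1), e k = -∑ k ∈ range (n + 1), e k := by
    conv_lhs => rw [← sum_range_reflect]
    rw [← sum_neg_distrib]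
    refine sum_congr rfl fun k hk => ?_
    rw [show n + 1 - 1 - k = n - k by omega, h2 k hk]
  have h4 : ∑ k ∈ range (n + 1), e k = 0 := by linear_combination h3 / 2
  rw [h1, h4, mul_zero]

end Literature.NumberTheory.Irrationality.FischlerRivoal2003
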